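import Literature.Analysis.FluidPDE.KNSSTypeIIZoomIn
import Literature.Analysis.FluidPDE.KNSSTypeIRateMildProofs
import Literature.Analysis.FluidPDE.KNSSTypeIRateLimit
import Literature.Analysis.FluidPDE.KNSSTypeIRateLiouvilleHolds
import Literature.Analysis.FluidPDE.AncientMildCompactness
import Literature.Analysis.FluidPDE.BoundedMildSmoothRemainder
import Literature.Analysis.FluidPDE.NSLerayOseenRepresentation
import Literature.Analysis.FluidPDE.NSBoundedMildOseenRestart
import Literature.Analysis.FluidPDE.NSBoundedMildSmoothing
import Literature.Analysis.FluidPDE.KNSSAxisymmetricNoSwirlHolds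
import Summits.NavierStokesRegularity.NavierStokesRegularity.Theorems.CertifiedBlowupCertifiedBlowupAxisymBlowupSwirlPersists
import Summits.NavierStokesRegularity.NavierStokesRegularity.Theorems.CertifiedBlowupCertifiedBlowupAxisymBlowupSwirlOrderParameter
import HarnessLib

/-!
# The restarted Oseen integral identity, pointwise, for a witness of the crux

Theorems file landed `--supports stmt-NavierStokesRegularity-0727` (crux `CertifiedBlowupAxisymBlowup`), line
`compact-amplification` (registered), sub-skeleton "axis-aware KNSS sup-zoom of a witness"
(`Cruxes/CertifiedBlowupAxisymBlowup/Lines/registered_zoom_probe.lean`), continuation lead c5.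
A witness of the crux is a classical solution `(u, p)` of Navier–Stokes (`ν = 1`, no force) on
`[0, T) × ℝ³` which is Leray–Hopf from its rapidly decaying axisymmetric datum. We prove that it
satisfies the Oseen integral identity restarted at every time `0 ≤ s < t < T` and *pointwise*:
`u(t, x) = e^{(t-s)Δ}u(s)(x) - B¹_s(u,u)(t)(x)`. Ingredients (all tree theorems): the pointwise
bound on closed sub-slabs (`bounded_before_of_lerayHopf_classical`), the representation formula
from time `0` of bounded Leray–Hopf solutions
(`ae_eq_heatExtension_sub_oseenDuhamel_of_isMildNSSolutionOn` with
`isMildNSSolutionOn_of_isLerayHopfOn_holds`), its restart at positive times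
(`oseenMild_restart_holds`), and the upgrade from a.e. to everywhere by continuity of both sides
(`contDiff_heatExtension_holds`, `continuous_oseenDuhamel_slice`, `Continuous.ae_eq_iff_eq`).

## References
* H. Koch, N. Nadirashvili, G. Seregin, V. Šverák, Acta Math. 203 (2009) 83–105 = arXiv:0709.3599, §4, §6. [KochNadirashviliSereginSverak2009]
-/

set_option linter.dupNamespace false

noncomputable section

open MeasureTheory Set Function Filter Topology Metric
open scoped NNReal ENNReal

namespace Summit.NavierStokesRegularity.NavierStokesRegularity.Theorems.CertifiedBlowupAxisymBlowup.CompactAmplification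

open Literature.Analysis Literature.Analysis.FluidPDE
open Summit.NavierStokesRegularity.NavierStokesRegularity.Theses.CertifiedBlowup

local notation "ℝ³" => EuclideanSpace ℝ (Fin 3)

/-- **The representation formula from time `0` on a closed sub-slab.** For a classical solution
`(u, p)` (`ν = 1`, no force) on `[0, T₁] × ℝ³`, Leray–Hopf on `[0, T₁)` from `u 0` and bounded by
`M > 0` on the closed slab, `u(t) = e^{tΔ}u(0) - B¹_0(u,u)(t)` a.e. for every `t ∈ (0, T₁]`
(the tree's `ae_eq_heatExtension_sub_oseenDuhamel_of_isMildNSSolutionOn`, fed with the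
duality-form mild formulation of a Leray–Hopf solution and the weak divergence-freeness of the
smooth datum). [cite: KochNadirashviliSereginSverak2009, §4 p. 8 (arXiv:0709.3599)] -/
theorem ae_eq_oseen_of_classical_lerayHopf_bounded {T₁ M : ℝ} {u : ℝ → ℝ³ → ℝ³} {p : ℝ → ℝ³ → ℝ}
    (hT₁ : 0 < T₁) (hcl : IsClassicalNSSolutionOn (Icc 0 T₁) 1 0 u p)
    (hLH : IsLerayHopfOn T₁ 1 0 (u 0) u) (hM : 0 < M) (hMb : ∀ τ ∈ Icc 0 T₁, ∀ y, ‖u τ y‖ ≤ M) :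
    ∀ t ∈ Ioc 0 T₁, u t =ᵐ[volume] fun x =>
      UnboundedOperators.heatExtension (u 0) (1 * t) x - oseenDuhamel 1 0 u u t x := by
  intro t ht
  have hν : (0 : ℝ) < 1 := one_pos
  have h0I : (0 : ℝ) ∈ Icc 0 T₁ := ⟨le_rfl, hT₁.le⟩
  have hcont : ContinuousOn (uncurry u) (Icc 0 T₁ ×ˢ univ) := hcl.smooth_velocity.continuousOn
  have hsl : ∀ τ ∈ Icc 0 T₁, AEStronglyMeasurable (u τ) volume := fun τ hτ =>
    (hcl.contDiff_velocity hτ).continuous.aestronglyMeasurable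
  have hmeas : AEStronglyMeasurable (uncurry u)
      ((volume : Measure (ℝ × ℝ³)).restrict (Ioo 0 T₁ ×ˢ univ)) :=
    (hcont.mono (prod_mono Ioo_subset_Icc_self Subset.rfl)).aestronglyMeasurable
      (measurableSet_Ioo.prod MeasurableSet.univ)
  have hdiv0 : IsWeaklyDivFree (u 0) :=
    VectorCalculus.IsDivFree.isWeaklyDivFree_holds (hcl.divFree 0 h0I)
      ((hcl.contDiff_velocity h0I).of_le (by norm_cast))
  have h2 : ∀ τ ∈ Icc 0 T₁, MemLp (u τ) 2 volume := fun τ hτ => hLH.memLp τ hτ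
  have hmild : IsMildNSSolutionOn (Ioc 0 T₁) 1 0 (u 0) u :=
    isMildNSSolutionOn_of_isLerayHopfOn_holds hν hT₁ (h2 0 h0I) hLH
  exact ae_eq_heatExtension_sub_oseenDuhamel_of_isMildNSSolutionOn hν hT₁ hmild hmeas hsl hM hMb
    hdiv0 h2 ht

/-- **The restarted representation formula, a.e., on a closed sub-slab.** Under the hypotheses of
`ae_eq_oseen_of_classical_lerayHopf_bounded`, for all `0 ≤ s < t < T₁`,
`u(t) = e^{(t-s)Δ}u(s) - B¹_s(u,u)(t)` a.e.: for `s = 0` this is the previous lemma, for `s > 0`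
it is its restart `oseenMild_restart_holds` (KNSS 2009, §4: the integral equation as an ODE in
`t`), whose uniform essential bound comes from the pointwise bound `M`.
[cite: KochNadirashviliSereginSverak2009, §4 p. 8 and Rem. 4.1 (arXiv:0709.3599)] -/
theorem ae_eq_oseen_restart_of_classical_lerayHopf_bounded {T₁ M : ℝ} {u : ℝ → ℝ³ → ℝ³}
    {p : ℝ → ℝ³ → ℝ} (hT₁ : 0 < T₁) (hcl : IsClassicalNSSolutionOn (Icc 0 T₁) 1 0 u p)
    (hLH : IsLerayHopfOn T₁ 1 0 (u 0) u) (hM : 0 < M) (hMb : ∀ τ ∈ Icc 0 T₁, ∀ y, ‖u τ y‖ ≤ M)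
    {s t : ℝ} (hs : 0 ≤ s) (hst : s < t) (htT₁ : t < T₁) :
    u t =ᵐ[volume] fun x =>
      UnboundedOperators.heatExtension (u s) (1 * (t - s)) x - oseenDuhamel 1 s u u t x := by
  have hν : (0 : ℝ) < 1 := one_pos
  have ht0 : 0 < t := lt_of_le_of_lt hs hst
  have hrep := ae_eq_oseen_of_classical_lerayHopf_bounded hT₁ hcl hLH hM hMb
  rcases eq_or_lt_of_le hs with h | h
  · subst h
    simpa only [sub_zero] using hrep t ⟨ht0, htT₁.le⟩
  · have h0I : (0 : ℝ) ∈ Icc 0 T₁ := ⟨le_rfl, hT₁.le⟩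
    have hcont : ContinuousOn (uncurry u) (Icc 0 T₁ ×ˢ univ) := hcl.smooth_velocity.continuousOn
    have hmeas : AEStronglyMeasurable (uncurry u)
        ((volume : Measure (ℝ × ℝ³)).restrict (Ioo 0 T₁ ×ˢ univ)) :=
      (hcont.mono (prod_mono Ioo_subset_Icc_self Subset.rfl)).aestronglyMeasurable
        (measurableSet_Ioo.prod MeasurableSet.univ)
    have hsl0 : AEStronglyMeasurable (u 0) volume :=
      (hcl.contDiff_velocity h0I).continuous.aestronglyMeasurable
    have hbd : ∀ T₂ ∈ Ioo 0 T₁, ∃ C : ℝ≥0∞, C < ∞ ∧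
        ∀ τ ∈ Ico 0 T₂, eLpNorm (u τ) ∞ volume ≤ C := by
      intro T₂ hT₂
      refine ⟨ENNReal.ofReal M, ENNReal.ofReal_lt_top, fun τ hτ => ?_⟩
      rw [eLpNorm_exponent_top]
      exact eLpNormEssSup_le_of_ae_bound
        (Eventually.of_forall (hMb τ ⟨hτ.1, hτ.2.le.trans hT₂.2.le⟩))
    have hint : ∀ τ ∈ Ioo 0 T₁, u τ =ᵐ[volume] fun x =>
        UnboundedOperators.heatExtension (u 0) (1 * τ) x - oseenDuhamel 1 0 u u τ x :=
      fun τ hτ => hrep τ ⟨hτ.1, hτ.2.le⟩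
    exact oseenMild_restart_holds ℝ³ hν hT₁ hmeas hsl0 hbd hint h hst htT₁

/-- **The witness satisfies the Oseen integral identity, restarted, pointwise** (stub Z1 of the
zoom sub-skeleton). For a classical solution `(u, p)` of Navier–Stokes (`ν = 1`, no force) on
`[0, T) × ℝ³`, Leray–Hopf from its rapidly decaying axisymmetric datum, and all `0 ≤ s < t < T`,
`u(t, x) = e^{(t-s)Δ}u(s)(x) - B¹_s(u,u)(t)(x)` for every `x`. Proof: on the closed sub-slab
`[0, T₁]`, `T₁ = (t+T)/2`, the solution is bounded (`bounded_before_of_lerayHopf_classical`),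
so the a.e. identity `ae_eq_oseen_restart_of_classical_lerayHopf_bounded` holds; both sides are
continuous in `x` (`u t` is smooth; `contDiff_heatExtension_holds` for the bounded slice `u s`;
`continuous_oseenDuhamel_slice`), hence equal everywhere (`Continuous.ae_eq_iff_eq`).
[cite: KochNadirashviliSereginSverak2009, §4 p. 8 and §6 (arXiv:0709.3599)] -/
theorem zoom_oseen_of_witness : ∀ {T : ℝ} {u : ℝ → ℝ³ → ℝ³} {p : ℝ → ℝ³ → ℝ}, 0 < T →
    IsClassicalNSSolutionOn (Ico 0 T) 1 0 u p → IsLerayHopfOn T 1 0 (u 0) u →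
    HasRapidSpatialDecay (u 0) → IsAxisymmetric (u 0) →
    ∀ s t : ℝ, 0 ≤ s → s < t → t < T → ∀ x,
      u t x = UnboundedOperators.heatExtension (u s) (t - s) x - oseenDuhamel 1 s u u t x := by
  intro T u p _hT hcl hLH hdec haxi s t hs hst htT
  have hν : (0 : ℝ) < 1 := one_pos
  -- ### a closed sub-slab `[0, T₁]`, `t < T₁ < T`, and a bound on it
  set T₁ : ℝ := (t + T) / 2 with hT₁
  have htT₁ : t < T₁ := by rw [hT₁]; linarith
  have hT₁T : T₁ < T := by rw [hT₁]; linarith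
  have ht0 : 0 < t := lt_of_le_of_lt hs hst
  have hT₁0 : 0 < T₁ := ht0.trans htT₁
  obtain ⟨M₀, hM₀⟩ := bounded_before_of_lerayHopf_classical hν hcl hLH hdec haxi T₁ hT₁T
  set M : ℝ := max M₀ 1 with hM
  have hM0 : 0 < M := lt_of_lt_of_le one_pos (le_max_right _ _)
  have hMb : ∀ τ ∈ Icc 0 T₁, ∀ y, ‖u τ y‖ ≤ M := fun τ hτ y =>
    (hM₀ τ hτ y).trans (le_max_left _ _)
  -- ### restriction of the solution to the closed sub-slab
  have hcl₁ : IsClassicalNSSolutionOn (Icc 0 T₁) 1 0 u p :=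
    hcl.mono (Icc_subset_Ico_right hT₁T) (uniqueDiffOn_Icc hT₁0)
  have hLH₁ : IsLerayHopfOn T₁ 1 0 (u 0) u := IsLerayHopfOn.mono_holds hLH hT₁T.le
  -- ### the a.e. identity
  have hae := ae_eq_oseen_restart_of_classical_lerayHopf_bounded hT₁0 hcl₁ hLH₁ hM0 hMb hs hst htT₁
  -- ### continuity of both sides
  have hsI : s ∈ Icc 0 T₁ := ⟨hs, (hst.trans htT₁).le⟩
  have htI : t ∈ Icc 0 T₁ := ⟨ht0.le, htT₁.le⟩
  have hcu : Continuous (u t) := (hcl₁.contDiff_velocity htI).continuous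
  have husm : MemLp (u s) ∞ (volume : Measure ℝ³) :=
    memLp_top_of_bound (hcl₁.contDiff_velocity hsI).continuous.aestronglyMeasurable M
      (Eventually.of_forall (hMb s hsI))
  have hts : 0 < t - s := sub_pos.2 hst
  have hch : Continuous (UnboundedOperators.heatExtension (u s) (t - s)) :=
    (UnboundedOperators.contDiff_heatExtension_holds husm le_top hts).continuous
  have hcont : ContinuousOn (uncurry u) (Icc 0 T₁ ×ˢ univ) := hcl₁.smooth_velocity.continuousOn
  have hmeas_s : AEStronglyMeasurable (uncurry u)
      ((volume : Measure (ℝ × ℝ³)).restrict (Ioo s T₁ ×ˢ univ)) :=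
    (hcont.mono (prod_mono (fun τ hτ => ⟨hs.trans hτ.1.le, hτ.2.le⟩) Subset.rfl)).aestronglyMeasurable
      (measurableSet_Ioo.prod MeasurableSet.univ)
  have hbd_s : ∀ τ ∈ Ioo s T₁, ∀ y, ‖u τ y‖ ≤ M := fun τ hτ y =>
    hMb τ ⟨hs.trans hτ.1.le, hτ.2.le⟩ y
  have hcB : Continuous (oseenDuhamel 1 s u u t) :=
    continuous_oseenDuhamel_slice hν hM0.le hmeas_s hmeas_s hbd_s hbd_s hst htT₁.le
  -- ### a.e. equal continuous functions are equal
  have hcr : Continuous fun x =>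
      UnboundedOperators.heatExtension (u s) (t - s) x - oseenDuhamel 1 s u u t x :=
    hch.sub hcB
  have heq : u t = fun x =>
      UnboundedOperators.heatExtension (u s) (t - s) x - oseenDuhamel 1 s u u t x := by
    refine (Continuous.ae_eq_iff_eq volume hcu hcr).1 ?_
    simpa only [one_mul] using hae
  intro x
  exact congrFun heq x

end Summit.NavierStokesRegularity.NavierStokesRegularity.Theorems.CertifiedBlowupAxisymBlowup.CompactAmplification

end
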